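import Mathlib.Analysis.SpecificLimits.Normed
import Summits.QuantumAdvantage.AdviceFreeQNC0.LowDegreeResidueAvoidance
import HarnessLib

/-!
# Cell qa-qnc0 (rung F-Q1, route RingFrame): the β-chain links `ElimSqrtOfSparse` and `ElimHardOfSqrt`

The RingFrame pack (HOME/qa-qnc0-p2/route-pack/v2) reduces the interface statement `ElimHard`
(two-bit elimination against `|u| mod 3` is hard for every polylog degree) to the avoidance
statement `LowDegAvoidMod3Sparse` through two supports:

* `ElimSqrtOfSparse : LowDegAvoidMod3Sparse → ElimSqrtDec` — the four level sets
  `{a = α, b = β}` of a pair `(a, b)` of degree-`≤ d` polynomials over `𝔽₂` have degree-`≤ 2d`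
  indicators `(a + α + 1)(b + β + 1)` and partition the cube; the eliminator with decoder `dec`
  fails on `{a = α, b = β} ∩ {|u| ≡ dec(α,β) (mod 3)}`, so if it fails on `< η·2ⁿ` inputs every level
  set is `γ`-sparse (`γ = 1/5 < 1/4`), contradicting `Σ |S_{αβ}| = 2ⁿ`
  (qn-p1 TARGET §11.2 / Sketch2 `elimSqrt_of_noLowDegAvoidMod3`, adapted to the free decoder);
* `ElimHardOfSqrt : ElimSqrtDec → ElimHard` — `(log₂ n)^C ≤ c₀√n` eventually (qn-p1 Sketch2
  `logPow_le_sqrt`, `elimConstAll_of_elimSqrt`).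

Both are proved here as theorems whose types are the pack's item texts verbatim
(`elimSqrtDec_of_lowDegAvoidMod3Sparse`, `elimHard_of_elimSqrtDec`), over tree vocabulary only
(`Smolensky.CubeFn/lowDeg`, `Hegedus.wt`); together with `lowDegAvoidMod3Sparse`
(`LowDegreeResidueAvoidance.lean`, the conclusion of crux β, proved from Srinivasan's robust
Hegedűs lemma) they make the interface statement itself a theorem: `elimHard` — every pair of
`𝔽₂`-polynomials of degree `≤ (log₂ n)^C` with any decoder names the true residue `|u| mod 3` on
at least `η₀·2ⁿ` inputs (`η₀ > 0` absolute). So at route birth every item of RingFrame except the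
crux α `RingToElim` (and the assembly) closes from the tree. WHAT THIS IS NOT: nothing on crux α
(`RingToElim`); no separation.
-/

noncomputable section

namespace Summit.QuantumAdvantage.AdviceFreeQNC0

open Finset
open Literature.Computability.MetaComplexity Literature.Computability.MetaComplexity.Smolensky
open Literature.Computability.MetaComplexity.Hegedus

variable {n : ℕ}

/-! ### Level sets of a pair of `𝔽₂`-polynomials -/

/-- Over `𝔽₂`: `x + α + 1 ≠ 0 ↔ x = α`. -/
private theorem zmod2_add_add_one_ne_zero_iff (x α : ZMod 2) : x + α + 1 ≠ 0 ↔ x = α := by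
  revert x α; decide

/-- The indicator `(a + α + 1)(b + β + 1)` of the level set `{a = α, b = β}` has degree `≤ d + d`. -/
private theorem levelInd_mem_lowDeg {d : ℕ} {a b : CubeFn (ZMod 2) n}
    (ha : a ∈ lowDeg (ZMod 2) n d) (hb : b ∈ lowDeg (ZMod 2) n d) (α β : ZMod 2) :
    (a + (fun _ => α + 1)) * (b + (fun _ => β + 1)) ∈ lowDeg (ZMod 2) n (d + d) := by
  have hconst : ∀ c : ZMod 2, (fun _ : Fin n → Bool => c) ∈ lowDeg (ZMod 2) n d := by
    intro c
    have h1 : (1 : CubeFn (ZMod 2) n) ∈ lowDeg (ZMod 2) n d := by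
      rw [← mono_empty]
      exact mono_mem_lowDeg (by simp)
    have : (fun _ : Fin n → Bool => c) = c • (1 : CubeFn (ZMod 2) n) := by
      funext u; simp
    rw [this]
    exact Submodule.smul_mem _ c h1
  exact mul_mem_lowDeg_add (Submodule.add_mem _ ha (hconst _)) (Submodule.add_mem _ hb (hconst _))

/-- The support of the indicator is the level set. -/
private theorem levelInd_ne_zero_iff (a b : CubeFn (ZMod 2) n) (α β : ZMod 2) (u : Fin n → Bool) :
    ((a + (fun _ => α + 1)) * (b + (fun _ => β + 1)) : CubeFn (ZMod 2) n) u ≠ 0 ↔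
      a u = α ∧ b u = β := by
  simp only [Pi.mul_apply, Pi.add_apply, mul_ne_zero_iff]
  rw [← add_assoc, ← add_assoc, zmod2_add_add_one_ne_zero_iff, zmod2_add_add_one_ne_zero_iff]

/-- The four level sets partition the cube: `Σ_{α,β} #{a = α, b = β} = 2ⁿ`. -/
private theorem sum_card_levelSets (a b : CubeFn (ZMod 2) n) :
    ∑ p ∈ (univ : Finset (ZMod 2 × ZMod 2)),
      (univ.filter fun u : Fin n → Bool => a u = p.1 ∧ b u = p.2).card = 2 ^ n := by
  have h := card_eq_sum_card_fiberwise (s := (univ : Finset (Fin n → Bool)))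
    (t := (univ : Finset (ZMod 2 × ZMod 2))) (f := fun u => (a u, b u)) (fun _ _ => mem_univ _)
  have hU : (univ : Finset (Fin n → Bool)).card = 2 ^ n := by simp
  rw [← hU, h]
  refine sum_congr rfl fun p _ => ?_
  congr 1
  ext u
  simp [Prod.ext_iff]

/-! ### `ElimSqrtOfSparse` -/

/-- **Support `ElimSqrtOfSparse` of RingFrame (pack v2), proved**: `LowDegAvoidMod3Sparse → ElimSqrtDec`. -/
theorem elimSqrtDec_of_lowDegAvoidMod3Sparse :
    (∀ γ : ℝ, 0 < γ → ∃ η : ℝ, 0 < η ∧ ∃ c₁ : ℝ, 0 < c₁ ∧ ∃ n₀ : ℕ, ∀ n ≥ n₀, ∀ r d : ℕ,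
      (d : ℝ) ≤ c₁ * Real.sqrt n → ∀ g : Smolensky.CubeFn (ZMod 2) n,
        g ∈ Smolensky.lowDeg (ZMod 2) n d →
          ((Finset.univ.filter fun u : Fin n → Bool => g u ≠ 0 ∧ Hegedus.wt u % 3 = r % 3).card : ℝ)
              ≤ η * (2 : ℝ) ^ n →
          ((Finset.univ.filter fun u : Fin n → Bool => g u ≠ 0).card : ℝ) ≤ γ * (2 : ℝ) ^ n) →
    (∃ η₀ : ℝ, 0 < η₀ ∧ ∃ c₀ : ℝ, 0 < c₀ ∧ ∃ n₀ : ℕ, ∀ n ≥ n₀, ∀ d : ℕ, (d : ℝ) ≤ c₀ * Real.sqrt n →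
      ∀ a b : Smolensky.CubeFn (ZMod 2) n, a ∈ Smolensky.lowDeg (ZMod 2) n d →
        b ∈ Smolensky.lowDeg (ZMod 2) n d → ∀ dec : ZMod 2 → ZMod 2 → ℕ,
          η₀ * (2 : ℝ) ^ n ≤ ((Finset.univ.filter fun u : Fin n → Bool =>
            dec (a u) (b u) % 3 = Hegedus.wt u % 3).card : ℝ)) := by
  intro hS
  obtain ⟨η, hη, c₁, hc₁, n₀, H⟩ := hS (1 / 5) (by norm_num)
  refine ⟨η, hη, c₁ / 2, by positivity, n₀, ?_⟩
  intro n hn d hd a b ha hb dec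
  by_contra hlt
  rw [not_le] at hlt
  have hd2 : ((d + d : ℕ) : ℝ) ≤ c₁ * Real.sqrt n := by push_cast; linarith
  -- every level set is `1/5`-sparse
  have key : ∀ α β : ZMod 2,
      ((univ.filter fun u : Fin n → Bool => a u = α ∧ b u = β).card : ℝ) ≤ 1 / 5 * (2 : ℝ) ^ n := by
    intro α β
    set g : CubeFn (ZMod 2) n := (a + (fun _ => α + 1)) * (b + (fun _ => β + 1)) with hg
    have hgd : g ∈ lowDeg (ZMod 2) n (d + d) := levelInd_mem_lowDeg ha hb α β
    have hsupp : (univ.filter fun u : Fin n → Bool => g u ≠ 0) =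
        univ.filter fun u : Fin n → Bool => a u = α ∧ b u = β :=
      filter_congr fun u _ => levelInd_ne_zero_iff a b α β u
    have hclass : ((univ.filter fun u : Fin n → Bool => g u ≠ 0 ∧ wt u % 3 = dec α β % 3).card : ℝ)
        ≤ η * (2 : ℝ) ^ n := by
      have hsub : (univ.filter fun u : Fin n → Bool => g u ≠ 0 ∧ wt u % 3 = dec α β % 3) ⊆
          univ.filter fun u : Fin n → Bool => dec (a u) (b u) % 3 = wt u % 3 := by
        intro u hu
        rw [mem_filter] at hu ⊢
        obtain ⟨hau, hbu⟩ := (levelInd_ne_zero_iff a b α β u).1 hu.2.1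
        refine ⟨hu.1, ?_⟩
        rw [hau, hbu]
        exact hu.2.2.symm
      have := card_le_card hsub
      have : ((univ.filter fun u : Fin n → Bool => g u ≠ 0 ∧ wt u % 3 = dec α β % 3).card : ℝ) ≤
          ((univ.filter fun u : Fin n → Bool => dec (a u) (b u) % 3 = wt u % 3).card : ℝ) := by
        exact_mod_cast this
      linarith
    have hres := H n hn (dec α β) (d + d) hd2 g hgd hclass
    rwa [hsupp] at hres
  -- but the four level sets cover the cube
  have hsum := sum_card_levelSets a b
  have hsumR : ∑ p ∈ (univ : Finset (ZMod 2 × ZMod 2)),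
      ((univ.filter fun u : Fin n → Bool => a u = p.1 ∧ b u = p.2).card : ℝ) = (2 : ℝ) ^ n := by
    exact_mod_cast hsum
  have hle : ∑ p ∈ (univ : Finset (ZMod 2 × ZMod 2)),
      ((univ.filter fun u : Fin n → Bool => a u = p.1 ∧ b u = p.2).card : ℝ) ≤
        ∑ _p ∈ (univ : Finset (ZMod 2 × ZMod 2)), 1 / 5 * (2 : ℝ) ^ n :=
    sum_le_sum fun p _ => key p.1 p.2
  rw [sum_const, card_univ] at hle
  have hcard : Fintype.card (ZMod 2 × ZMod 2) = 4 := by simp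
  rw [hcard, hsumR] at hle
  have hpos : (0 : ℝ) < (2 : ℝ) ^ n := by positivity
  norm_num at hle
  linarith

/-! ### `ElimHardOfSqrt` -/

/-- `(log₂ n)^C ≤ c₀ √n` for `n ≥ n₀(C, c₀)` (qn-p1 Sketch2 `logPow_le_sqrt`). -/
private theorem logPow_le_sqrt (C : ℕ) {c₀ : ℝ} (hc₀ : 0 < c₀) :
    ∃ n₀ : ℕ, ∀ n : ℕ, n₀ ≤ n → ((Nat.log 2 n ^ C : ℕ) : ℝ) ≤ c₀ * Real.sqrt n := by
  have hr : (1 : ℝ) < Real.sqrt 2 := by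
    rw [show (1 : ℝ) = Real.sqrt 1 by simp]
    exact Real.sqrt_lt_sqrt (by norm_num) (by norm_num)
  have ht := tendsto_pow_const_div_const_pow_of_one_lt C hr
  obtain ⟨K₀, hK₀⟩ := Filter.eventually_atTop.1 (ht.eventually_le_const hc₀)
  refine ⟨2 ^ K₀, fun n hn => ?_⟩
  have hn0 : n ≠ 0 := by
    have : 0 < 2 ^ K₀ := Nat.pos_of_ne_zero (by positivity)
    omega
  set k := Nat.log 2 n with hk_def
  have hk : K₀ ≤ k := Nat.le_log_of_pow_le one_lt_two hn
  have h2k : (2 : ℝ) ^ k ≤ n := by exact_mod_cast Nat.pow_log_le_self 2 hn0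
  have hs_pos : 0 < Real.sqrt 2 ^ k := pow_pos (by positivity) k
  have hsq2 : (Real.sqrt 2 ^ k) ^ 2 = (2 : ℝ) ^ k := by
    rw [← pow_mul, mul_comm, pow_mul, Real.sq_sqrt (by norm_num : (0 : ℝ) ≤ 2)]
  have hle : Real.sqrt 2 ^ k ≤ Real.sqrt n := Real.le_sqrt_of_sq_le (by rw [hsq2]; exact h2k)
  have hK := hK₀ k hk
  rw [div_le_iff₀ hs_pos] at hK
  push_cast
  calc (k : ℝ) ^ C ≤ c₀ * Real.sqrt 2 ^ k := hK
    _ ≤ c₀ * Real.sqrt n := by gcongr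

/-- **Support `ElimHardOfSqrt` of RingFrame (pack v2), proved**: `ElimSqrtDec → ElimHard`. -/
theorem elimHard_of_elimSqrtDec :
    (∃ η₀ : ℝ, 0 < η₀ ∧ ∃ c₀ : ℝ, 0 < c₀ ∧ ∃ n₀ : ℕ, ∀ n ≥ n₀, ∀ d : ℕ, (d : ℝ) ≤ c₀ * Real.sqrt n →
      ∀ a b : Smolensky.CubeFn (ZMod 2) n, a ∈ Smolensky.lowDeg (ZMod 2) n d →
        b ∈ Smolensky.lowDeg (ZMod 2) n d → ∀ dec : ZMod 2 → ZMod 2 → ℕ,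
          η₀ * (2 : ℝ) ^ n ≤ ((Finset.univ.filter fun u : Fin n → Bool =>
            dec (a u) (b u) % 3 = Hegedus.wt u % 3).card : ℝ)) →
    (∃ η₀ : ℝ, 0 < η₀ ∧ ∀ C : ℕ, ∃ n₀ : ℕ, ∀ n ≥ n₀, ∀ a b : Smolensky.CubeFn (ZMod 2) n,
      a ∈ Smolensky.lowDeg (ZMod 2) n ((Nat.log 2 n) ^ C) →
        b ∈ Smolensky.lowDeg (ZMod 2) n ((Nat.log 2 n) ^ C) → ∀ dec : ZMod 2 → ZMod 2 → ℕ,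
          η₀ * (2 : ℝ) ^ n ≤ ((Finset.univ.filter fun u : Fin n → Bool =>
            dec (a u) (b u) % 3 = Hegedus.wt u % 3).card : ℝ)) := by
  rintro ⟨η₀, hη₀, c₀, hc₀, n₀, H⟩
  refine ⟨η₀, hη₀, fun C => ?_⟩
  obtain ⟨n₁, hn₁⟩ := logPow_le_sqrt C hc₀
  refine ⟨max n₀ n₁, fun n hn a b ha hb dec => ?_⟩
  exact H n (le_trans (le_max_left _ _) hn) (Nat.log 2 n ^ C)
    (hn₁ n (le_trans (le_max_right _ _) hn)) a b ha hb dec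

/-! ### The interface statement `ElimHard` is a theorem -/

/-- **`ElimHard` (pack v2, the hypothesis of crux α `RingToElim`), PROVED**: there is an absolute
`η₀ > 0` such that for every `C`, for all large `n`, every pair `a, b` of `𝔽₂`-polynomials of
degree `≤ (log₂ n)^C` and every decoder `dec : 𝔽₂ × 𝔽₂ → ℕ`, the claimed residue `dec(a u, b u)`
EQUALS `|u| mod 3` for at least `η₀·2ⁿ` points `u` — two-bit elimination against the Hamming
weight mod 3 is impossible at polylog degree. (= `elimHard_of_elimSqrtDec ∘
elimSqrtDec_of_lowDegAvoidMod3Sparse` applied to `lowDegAvoidMod3Sparse`; ultimately Srinivasan's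
robust Hegedűs lemma, Sri23 L3.1.) -/
theorem elimHard :
    ∃ η₀ : ℝ, 0 < η₀ ∧ ∀ C : ℕ, ∃ n₀ : ℕ, ∀ n ≥ n₀, ∀ a b : Smolensky.CubeFn (ZMod 2) n,
      a ∈ Smolensky.lowDeg (ZMod 2) n ((Nat.log 2 n) ^ C) →
        b ∈ Smolensky.lowDeg (ZMod 2) n ((Nat.log 2 n) ^ C) → ∀ dec : ZMod 2 → ZMod 2 → ℕ,
          η₀ * (2 : ℝ) ^ n ≤ ((Finset.univ.filter fun u : Fin n → Bool =>
            dec (a u) (b u) % 3 = Hegedus.wt u % 3).card : ℝ) :=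
  elimHard_of_elimSqrtDec (elimSqrtDec_of_lowDegAvoidMod3Sparse lowDegAvoidMod3Sparse)

end Summit.QuantumAdvantage.AdviceFreeQNC0
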